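import Literature.NumberTheory.LFunctions.DirichletLDerivativeLogSqBound
import Literature.NumberTheory.LFunctions.RealZeroEffectiveRepulsionExplicit
import Literature.NumberTheory.LFunctions.NoRealZeroSmallModuliIII
import HarnessLib

/-!
# Kernel-proved Page-type repulsion of real zeros, v2:
# `1 − β ≥ 2/(3 √q (log q)²)` for every real primitive `χ` mod `q ≥ 3` (was `1/400`)

Topic `Literature/NumberTheory/LFunctions`. Everything in this file is PROVED (theorems only; no
definition, no named fact). Second part of `RealZeroEffectiveRepulsionExplicit.lean` (rc-cond g5): the
crude mean-value constant `‖L(1,χ)‖ ≤ 55 (1 − β)(log q)²` there (sup of `|L|` on discs, Montgomery–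
Vaughan's proof of Cor. 11.15) is replaced by `‖L(1,χ)‖ ≤ (1 − β)(log q)²` (`q ≥ 232`,
`β ≥ 1 − 1/(40 log q)`; `DirichletLDerivativeLogSqBound.lean`, from the Pólya–Vinogradov-strength
derivative bound of `DirichletLDerivativeExplicitBound.lean`):

* `one_sub_realZero_ge_two_thirds` — **for every `q ≥ 3`, every primitive quadratic `χ` mod `q` and
  every real zero `β` of `L(s, χ)`: `2/(3 √q (log q)²) ≤ 1 − β`** (conductors `q ≤ 231` have no zero
  in `(0, 1)` at all by the kernel base `noRealZeroUpTo_231` — Fekete–Pólya certificates, MV §11.2.1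
  Exercises 7–8 — so `β ≤ 0` there; above `232` the class-number-formula floor `‖L(1,χ)‖ ≥ 0.69/√q`
  (`norm_LFunction_one_ge`) meets `‖L(1,χ)‖ ≤ (1 − β)(log q)²`, and a zero below `1 − 1/(40 log q)` is
  farther from `1` anyway);
* `one_sub_realZero_ge_three_halves` — `3/(2 √q (log q)²) ≤ 1 − β` for `q ≥ 10⁶`;
* `isSiegelZero_quality_le_three_halves` / `_two_thirds` — a Siegel zero of quality `η`
  (Tao–Teräväinen, `L(1 − 1/(η log q), χ) = 0`) at conductor `q` has `η ≤ (3/2) √q log q` (all `q ≥ 3`)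
  and `η ≤ (2/3) √q log q` (`q ≥ 10⁶`); `isSiegelZero_conductor_ge_third` — hence `q ≥ η/3`;
* `isSiegelZero_eta_le_log_sq_div` — quality `η ≥ 40` at `q ≥ 232` gives `‖L(1,χ)‖·log q ≤ (log q)²/η`
  (Friedlander–Iwaniec's `η(χ)` is at most `(log q)²/η`).

Compared with `RealZeroEffectiveRepulsionExplicit.lean`: `1/(400 √q log²q)` → `2/(3 √q log²q)`
(factor `267`), quality cap `400 √q log q` → `1.5 √q log q`, conductor floor `η/800` → `η/3`,
`55 (log q)²/η` → `(log q)²/η`. Print is still better by the logarithms (Ralaivaosaona–Razakarinoro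
2026: `1 − β > 6.035/√d`, odd `d > 3·10⁸`; Bordignon 2019/2020: `λ = 800` odd / `100` even in
`β ≤ 1 − λ/(√q log²q)`, `q > 4·10⁵` — tree facts); the point, as before, is that these are kernel
theorems uniform in `q ≥ 3`, resting on nothing unproved.

LABEL: instrument / comparator (kernel-certified explicit constants; parity-realchar TARGET §2 row 16,
v2). WHAT THIS IS NOT: not competitive with print; no certified-range leaf (`NoRealZeroUpTo_*` beyond the
unconditional kernel base `≤ 231`) is used.

## References

* H. Davenport, *Multiplicative Number Theory*, 2nd ed., GTM 74, Springer 1980, Ch. 14 (12).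
  [DavenportMNT1980]
* H. L. Montgomery, R. C. Vaughan, *Multiplicative Number Theory I*, CUP 2007, §11.2 Theorem 11.4
  (11.10), Corollary 11.15, §11.2.1 Exercises 3 (b), 7, 8. [MontgomeryVaughan2007]
* T. Tao, J. Teräväinen, *The Hardy–Littlewood–Chowla conjecture in the presence of a Siegel zero*,
  J. London Math. Soc. 106 (2022), Definition 1.4. [TaoTeravainen2021]
* J. B. Friedlander, H. Iwaniec, (1.6) (the quantity `η(χ) = L(1,χ) log q`). [FriedlanderIwaniec2019TwinPrimes]
-/

noncomputable section

open Complex Filter Topology Finset Set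

namespace Literature.NumberTheory.LFunctions

open Literature.Barriers.Parity DirichletAbel

namespace RealZeroRepulsion

/-- `log q > 2` for `q ≥ 8` (`log 8 = 3 log 2 > 2.07`). [folklore] -/
private theorem two_lt_log {q : ℕ} (hq : 8 ≤ q) : 2 < Real.log q := by
  have hq8 : (8 : ℝ) ≤ q := by exact_mod_cast hq
  have h8 : 2 < Real.log 8 := by
    rw [show (8 : ℝ) = 2 ^ 3 by norm_num, Real.log_pow]
    have := Real.log_two_gt_d9; push_cast; linarith
  exact lt_of_lt_of_le h8 (Real.log_le_log (by norm_num) hq8)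

/-! ### Repulsion v2: `1 − β ≥ 2/(3 √q log² q)` for all `q ≥ 3`, `≥ 3/(2 √q log² q)` for `q ≥ 10⁶` -/

/-- **Explicit repulsion, all conductors, v2**: every real zero `β` of `L(s, χ)`, `χ` primitive
quadratic mod `q ≥ 3`, has **`2/(3 √q (log q)²) ≤ 1 − β`** (was `1/(400 √q (log q)²)` in
`one_sub_realZero_ge_explicit`). For `q ≤ 231` there is no zero in `(0, 1)` at all (the kernel base
`noRealZeroUpTo_231`, Fekete–Pólya), so `β ≤ 0`; for `q ≥ 232` a zero `β ≥ 1 − 1/(40 log q)` gives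
`0.69/√q ≤ ‖L(1,χ)‖ ≤ (1 − β)(log q)²`, and a zero below `1 − 1/(40 log q)` is farther anyway.
[cite: DavenportMNT1980, Ch. 14 (12)] [cite: MontgomeryVaughan2007, §11.2.1 Exercises 3 (b), 7, 8] -/
theorem one_sub_realZero_ge_two_thirds {q : ℕ} [NeZero q] (hq : 3 ≤ q)
    {χ : DirichletCharacter ℂ q} (hprim : χ.IsPrimitive) (hquad : χ.IsQuadratic)
    {β : ℝ} (hzero : χ.LFunction β = 0) :
    2 / (3 * Real.sqrt q * Real.log q ^ 2) ≤ 1 - β := by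
  have hq3 : (3 : ℝ) ≤ q := by exact_mod_cast hq
  have hq0 : (0 : ℝ) < q := by linarith
  have hne : χ ≠ 1 := by
    rintro rfl
    rw [DirichletCharacter.isPrimitive_def, DirichletCharacter.conductor_one] at hprim
    omega
  have hβ1 : β < 1 := by
    by_contra hcon
    exact DirichletCharacter.LFunction_ne_zero_of_one_le_re χ (Or.inl hne) (s := β)
      (by simp; linarith) hzero
  have hlog3 : 1.09 < Real.log q := by
    have h3 : 1.09 < Real.log 3 := by
      rw [Real.lt_log_iff_exp_lt (by norm_num)]
      have h := Real.exp_one_lt_d9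
      have h09 : Real.exp (0.09 : ℝ) < 1.1 := by
        have := Real.exp_bound_div_one_sub_of_interval' (x := (0.09 : ℝ)) (by norm_num) (by norm_num)
        have h2 : (1 : ℝ) / (1 - 0.09) < 1.1 := by norm_num
        linarith
      have : Real.exp (1.09 : ℝ) = Real.exp 1 * Real.exp 0.09 := by
        rw [← Real.exp_add]; norm_num
      rw [this]; nlinarith [Real.exp_pos (0.09 : ℝ), Real.exp_pos (1 : ℝ)]
    exact lt_of_lt_of_le h3 (Real.log_le_log (by norm_num) hq3)
  have hL0 : 0 < Real.log q := by linarith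
  have hsq : 0 < Real.sqrt q := Real.sqrt_pos.mpr hq0
  have hsq3 : 1.7 ≤ Real.sqrt q := by
    have h17 : (1.7 : ℝ) ≤ Real.sqrt 3 := by
      rw [show (1.7 : ℝ) = Real.sqrt (1.7 ^ 2) by rw [Real.sqrt_sq (by norm_num)]]
      exact Real.sqrt_le_sqrt (by norm_num)
    exact h17.trans (Real.sqrt_le_sqrt hq3)
  have hden : 0 < 3 * Real.sqrt q * Real.log q ^ 2 := by positivity
  by_cases h232 : q ≤ 231
  · -- kernel base: no zero in `(0,1)`, hence `β ≤ 0`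
    have hβ0 : β ≤ 0 := by
      by_contra hcon
      push Not at hcon
      exact noRealZeroUpTo_231 q hq h232 χ hquad hprim β hcon hβ1 hzero
    rw [div_le_iff₀ hden]
    nlinarith [mul_pos hsq (pow_pos hL0 2), mul_le_mul hsq3 (show 1.09 ^ 2 ≤ Real.log q ^ 2 from
      pow_le_pow_left₀ (by norm_num) hlog3.le 2) (by norm_num) hsq.le]
  · push Not at h232
    have h232' : 232 ≤ q := by omega
    have hL2 := two_lt_log (show 8 ≤ q by omega)
    have hsq15 : 15 ≤ Real.sqrt q := by
      rw [show (15 : ℝ) = Real.sqrt (15 ^ 2) by rw [Real.sqrt_sq (by norm_num)]]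
      exact Real.sqrt_le_sqrt (by norm_num; exact_mod_cast (show 225 ≤ q by omega))
    set r : ℝ := 1 / (40 * Real.log q) with hrdef
    by_cases hfar : β < 1 - r
    · -- far zero: `1 − β > r = 1/(40 log q) ≥ 2/(3 √q log² q)` as `3 √q log q ≥ 80`
      have h1 : 2 / (3 * Real.sqrt q * Real.log q ^ 2) ≤ r := by
        rw [hrdef, div_le_div_iff₀ hden (by positivity)]
        nlinarith [mul_le_mul hsq15 hL2.le (by norm_num) hsq.le, hL0]
      linarith
    · rw [not_lt] at hfar
      have hup := norm_LFunction_one_le_log_sq_of_realZero h232' hprim hfar hzero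
      have hfloor := norm_LFunction_one_ge hq hprim hquad
      have key : 69 / 100 / Real.sqrt q ≤ (1 - β) * Real.log q ^ 2 := hfloor.trans hup
      rw [div_le_iff₀ hsq] at key
      rw [div_le_iff₀ hden]
      nlinarith [mul_pos hsq (pow_pos hL0 2)]

/-- **Explicit repulsion for `q ≥ 10⁶`, constant `3/2`**: every real zero `β` of `L(s, χ)`, `χ`
primitive quadratic mod `q ≥ 10⁶`, has `3/(2 √q (log q)²) ≤ 1 − β` (`‖L'‖ ≤ 0.46 log²q` near `1`,
`0.69/0.46 = 1.5`). [cite: DavenportMNT1980, Ch. 14 (12)] [cite: MontgomeryVaughan2007, §11.2.1 Exercise 3 (b)] -/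
theorem one_sub_realZero_ge_three_halves {q : ℕ} [NeZero q] (hq : 10 ^ 6 ≤ q)
    {χ : DirichletCharacter ℂ q} (hprim : χ.IsPrimitive) (hquad : χ.IsQuadratic)
    {β : ℝ} (hzero : χ.LFunction β = 0) :
    3 / (2 * Real.sqrt q * Real.log q ^ 2) ≤ 1 - β := by
  have hq2 : 2 ≤ q := le_trans (by norm_num) hq
  have hqr : (10 : ℝ) ^ 6 ≤ q := by exact_mod_cast hq
  have hq0 : (0 : ℝ) < q := by linarith
  have hne : χ ≠ 1 := by
    rintro rfl
    rw [DirichletCharacter.isPrimitive_def, DirichletCharacter.conductor_one] at hprim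
    omega
  have hβ1 : β < 1 := by
    by_contra hcon
    exact DirichletCharacter.LFunction_ne_zero_of_one_le_re χ (Or.inl hne) (s := β)
      (by simp; linarith) hzero
  have hL2 := two_lt_log (le_trans (by norm_num) hq)
  have hL0 : 0 < Real.log q := by linarith
  have hsq : 0 < Real.sqrt q := Real.sqrt_pos.mpr hq0
  have hsq1000 : 1000 ≤ Real.sqrt q := by
    rw [show (1000 : ℝ) = Real.sqrt (1000 ^ 2) by rw [Real.sqrt_sq (by norm_num)]]
    exact Real.sqrt_le_sqrt (by norm_num at hqr ⊢; linarith)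
  have hden : 0 < 2 * Real.sqrt q * Real.log q ^ 2 := by positivity
  set r : ℝ := 1 / (40 * Real.log q) with hrdef
  have hr1 : r < 1 := by rw [hrdef, div_lt_one (by positivity)]; linarith
  by_cases hfar : β < 1 - r
  · have h1 : 3 / (2 * Real.sqrt q * Real.log q ^ 2) ≤ r := by
      rw [hrdef, div_le_div_iff₀ hden (by positivity)]
      nlinarith [mul_le_mul hsq1000 hL2.le (by norm_num) hsq.le, hL0]
    linarith
  · rw [not_lt] at hfar
    have h := norm_LFunction_one_sub_le_of_norm_deriv_le χ hne hβ1.le fun σ h1 h2 =>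
      norm_deriv_LFunction_le_log_sq_of_ge_1e6 hq hprim (le_trans hfar h1) h2
    rw [hzero, sub_zero] at h
    have hfloor := norm_LFunction_one_ge (by omega) hprim hquad
    have key : 69 / 100 / Real.sqrt q ≤ 23 / 50 * Real.log q ^ 2 * (1 - β) := hfloor.trans h
    rw [div_le_iff₀ hsq] at key
    rw [div_le_iff₀ hden]
    nlinarith [mul_pos hsq (pow_pos hL0 2)]

/-! ### Readings on the Siegel-zero predicate -/

/-- **The quality of a Siegel zero is at most `(3/2) √q log q`** (all `q ≥ 3`; kernel-certified,
effective; was `400 √q log q` in `isSiegelZero_quality_le`). [cite: TaoTeravainen2021, Definition 1.4 and (1.4)]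
[cite: DavenportMNT1980, Ch. 14 (12)] -/
theorem isSiegelZero_quality_le_three_halves {q : ℕ} [NeZero q] (hq : 3 ≤ q)
    {χ : DirichletCharacter ℂ q} {η : ℝ} (hS : IsSiegelZero χ η) :
    η ≤ 3 / 2 * Real.sqrt q * Real.log q := by
  obtain ⟨hprim, hquad, h10, hzero⟩ := hS
  have hq3 : (3 : ℝ) ≤ q := by exact_mod_cast hq
  have hq0 : (0 : ℝ) < q := by linarith
  have hL0 : 0 < Real.log q := Real.log_pos (by linarith)
  have hsq : 0 < Real.sqrt q := Real.sqrt_pos.mpr hq0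
  have hη : 0 < η := by linarith
  have h := one_sub_realZero_ge_two_thirds hq hprim hquad hzero
  have h1β : 1 - (1 - 1 / (η * Real.log q)) = 1 / (η * Real.log q) := by ring
  rw [h1β, div_le_div_iff₀ (by positivity) (by positivity)] at h
  -- `2 η log q ≤ 3 √q log² q`
  have h' : η * Real.log q ≤ (3 / 2 * Real.sqrt q * Real.log q) * Real.log q := by nlinarith
  exact le_of_mul_le_mul_right h' hL0

/-- For `q ≥ 10⁶` the quality of a Siegel zero is at most `(2/3) √q log q`.
[cite: TaoTeravainen2021, Definition 1.4 and (1.4)] [cite: DavenportMNT1980, Ch. 14 (12)] -/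
theorem isSiegelZero_quality_le_two_thirds {q : ℕ} [NeZero q] (hq : 10 ^ 6 ≤ q)
    {χ : DirichletCharacter ℂ q} {η : ℝ} (hS : IsSiegelZero χ η) :
    η ≤ 2 / 3 * Real.sqrt q * Real.log q := by
  obtain ⟨hprim, hquad, h10, hzero⟩ := hS
  have hqr : (10 : ℝ) ^ 6 ≤ q := by exact_mod_cast hq
  have hq0 : (0 : ℝ) < q := by linarith
  have hL0 : 0 < Real.log q := Real.log_pos (by linarith)
  have hsq : 0 < Real.sqrt q := Real.sqrt_pos.mpr hq0
  have hη : 0 < η := by linarith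
  have h := one_sub_realZero_ge_three_halves hq hprim hquad hzero
  have h1β : 1 - (1 - 1 / (η * Real.log q)) = 1 / (η * Real.log q) := by ring
  rw [h1β, div_le_div_iff₀ (by positivity) (by positivity)] at h
  have h' : η * Real.log q ≤ (2 / 3 * Real.sqrt q * Real.log q) * Real.log q := by nlinarith
  exact le_of_mul_le_mul_right h' hL0

/-- **Effective location of high-quality Siegel zeros, v2**: a Siegel zero of quality `η` attached to a
conductor `q ≥ 3` has `q ≥ η/3` (from `η ≤ (3/2)√q log q` and `log q ≤ 2√q`; was `η/800`).
[cite: TaoTeravainen2021, Definition 1.4 and (1.4)] [cite: DavenportMNT1980, Ch. 14 (12)] -/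
theorem isSiegelZero_conductor_ge_third {q : ℕ} [NeZero q] (hq : 3 ≤ q) {χ : DirichletCharacter ℂ q}
    {η : ℝ} (hS : IsSiegelZero χ η) : η / 3 ≤ q := by
  have h := isSiegelZero_quality_le_three_halves hq hS
  have hq3 : (3 : ℝ) ≤ q := by exact_mod_cast hq
  have hq0 : (0 : ℝ) < q := by linarith
  have hsq : 0 < Real.sqrt q := Real.sqrt_pos.mpr hq0
  have hlog : Real.log q ≤ 2 * Real.sqrt q := by
    have h1 : Real.log (Real.sqrt q) ≤ Real.sqrt q - 1 := Real.log_le_sub_one_of_pos hsq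
    have h2 : Real.log q = 2 * Real.log (Real.sqrt q) := by
      rw [Real.log_sqrt hq0.le]; ring
    linarith
  have hqq : Real.sqrt q * Real.sqrt q = q := Real.mul_self_sqrt hq0.le
  rw [div_le_iff₀ (by norm_num : (0 : ℝ) < 3)]
  calc η ≤ 3 / 2 * Real.sqrt q * Real.log q := h
    _ ≤ 3 / 2 * Real.sqrt q * (2 * Real.sqrt q) :=
        mul_le_mul_of_nonneg_left hlog (by positivity)
    _ = (q : ℝ) * 3 := by nlinarith [hqq]

/-- **Quality ⇒ small `η(D)`, v2**: a Siegel zero of quality `η ≥ 40` attached to `χ` mod `q ≥ 232`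
forces `‖L(1, χ)‖ · log q ≤ (log q)²/η` (was `55 (log q)²/η`). So quality `η ≥ (log q)²/ε` already
gives Friedlander–Iwaniec's `η(χ) ≤ ε` for this character. [cite: TaoTeravainen2021, Definition 1.4]
[cite: MontgomeryVaughan2007, Theorem 11.4 (11.10)] [cite: FriedlanderIwaniec2019TwinPrimes, (1.6)] -/
theorem isSiegelZero_eta_le_log_sq_div {q : ℕ} [NeZero q] (hq : 232 ≤ q) {χ : DirichletCharacter ℂ q}
    {η : ℝ} (hS : IsSiegelZero χ η) (h40 : 40 ≤ η) :
    ‖χ.LFunction 1‖ * Real.log q ≤ Real.log q ^ 2 / η := by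
  obtain ⟨hprim, hquad, h10, hzero⟩ := hS
  have hL2 := two_lt_log (show 8 ≤ q by omega)
  have hL0 : 0 < Real.log q := by linarith
  have hη : 0 < η := by linarith
  -- `β = 1 − 1/(η log q) ≥ 1 − 1/(40 log q)` since `η ≥ 40`
  have hβ : 1 - 1 / (40 * Real.log q) ≤ 1 - 1 / (η * Real.log q) := by
    have : 1 / (η * Real.log q) ≤ 1 / (40 * Real.log q) :=
      one_div_le_one_div_of_le (by positivity) (by nlinarith)
    linarith
  have h := norm_LFunction_one_le_log_sq_of_realZero hq hprim hβ hzero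
  have h1β : 1 - (1 - 1 / (η * Real.log q)) = 1 / (η * Real.log q) := by ring
  rw [h1β] at h
  have h' : ‖χ.LFunction 1‖ ≤ Real.log q / η := by
    calc ‖χ.LFunction 1‖ ≤ 1 / (η * Real.log q) * Real.log q ^ 2 := h
      _ = Real.log q / η := by field_simp
  calc ‖χ.LFunction 1‖ * Real.log q ≤ (Real.log q / η) * Real.log q :=
        mul_le_mul_of_nonneg_right h' hL0.le
    _ = Real.log q ^ 2 / η := by ring

end RealZeroRepulsion

end Literature.NumberTheory.LFunctions
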